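import Summits.KontsevichZagierPeriods.KontsevichZagierPeriods.Theses.RootDecompRelativeModAbsolute

/-!
# Route RootDecompRelativeModAbsolute — `RelOneModAbsGlue` (item stmt-KontsevichZagierPeriods-28060)

GLUE of the gen-5 split (k = 2) of the deciding crux `RelOneModAbs` (item 26666) of node C″:
`CurveFamiliesModCurves → BaseLift → RelOneModAbs` — curve families modulo curve constants (B¹, item 28058, the
parent at base dimension 1) and base lift (β3, item 28059: O₁-closure over curves gives O₁-closure over every base
dimension) together give the parent. Pure logic: for a `[π]`-saturated two-sided ideal `R ⊇ relations ∪ Abs₁`,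
B¹ supplies the O₁-closure over curves that β3 asks for, and β3 returns O₁ over all bases, which is B's conclusion.
(= `relOneModAbs_of_curves_of_baseLift` of the decomp-kz lens-3 gen-5 node file
`run/shared/lean/pub/decomp-kz/decomp-kz-lens-3/g5/RelativeModAbsoluteCurves.lean`, critic CLEARED 2026-08-30T04:37:59Z,
retargeted to the route declarations by name.) Standard axioms, 0 sorry.
-/

namespace Summit.KontsevichZagierPeriods.RootDecompRelativeModAbsolute

open Summit.KontsevichZagierPeriods.KontsevichZagierPeriods.Theses.RootDecompRelativeModAbsolute

/-- **RelOneModAbsGlue** (item stmt-KontsevichZagierPeriods-28060): `CurveFamiliesModCurves → BaseLift → RelOneModAbs`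
— the split `RelOneModAbs ⟸ CurveFamiliesModCurves ∧ BaseLift` is glued by instantiating β3's curve hypothesis with B¹. -/
theorem relOneModAbsGlue_proof :
    Summit.KontsevichZagierPeriods.KontsevichZagierPeriods.Theses.RootDecompRelativeModAbsolute.RelOneModAbsGlue := by
  unfold Summit.KontsevichZagierPeriods.KontsevichZagierPeriods.Theses.RootDecompRelativeModAbsolute.RelOneModAbsGlue
    Summit.KontsevichZagierPeriods.KontsevichZagierPeriods.Theses.RootDecompRelativeModAbsolute.RelOneModAbs
    Summit.KontsevichZagierPeriods.KontsevichZagierPeriods.Theses.RootDecompRelativeModAbsolute.CurveFamiliesModCurves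
    Summit.KontsevichZagierPeriods.KontsevichZagierPeriods.Theses.RootDecompRelativeModAbsolute.BaseLift
  intro h₁ h₂ R hR hI hπ hA
  exact h₂ R hR hI hπ hA (h₁ R hR hI hπ hA)

/-- The converse direction of the split, for the record: the parent gives both children (so the split is EXACT,
`RelOneModAbs ↔ CurveFamiliesModCurves ∧ BaseLift`). -/
theorem curves_and_baseLift_of_relOneModAbs
    (hB : Summit.KontsevichZagierPeriods.KontsevichZagierPeriods.Theses.RootDecompRelativeModAbsolute.RelOneModAbs) :
    Summit.KontsevichZagierPeriods.KontsevichZagierPeriods.Theses.RootDecompRelativeModAbsolute.CurveFamiliesModCurves ∧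
      Summit.KontsevichZagierPeriods.KontsevichZagierPeriods.Theses.RootDecompRelativeModAbsolute.BaseLift := by
  unfold Summit.KontsevichZagierPeriods.KontsevichZagierPeriods.Theses.RootDecompRelativeModAbsolute.RelOneModAbs at hB
  unfold Summit.KontsevichZagierPeriods.KontsevichZagierPeriods.Theses.RootDecompRelativeModAbsolute.CurveFamiliesModCurves
    Summit.KontsevichZagierPeriods.KontsevichZagierPeriods.Theses.RootDecompRelativeModAbsolute.BaseLift
  refine ⟨fun R hR hI hπ hA r r' hae => hB R hR hI hπ hA r r' hae, fun R hR hI hπ hA _ => hB R hR hI hπ hA⟩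

/-- **The split of item 26666 is exact (k = 2).** -/
theorem relOneModAbs_iff_curves_and_baseLift :
    Summit.KontsevichZagierPeriods.KontsevichZagierPeriods.Theses.RootDecompRelativeModAbsolute.RelOneModAbs ↔
      (Summit.KontsevichZagierPeriods.KontsevichZagierPeriods.Theses.RootDecompRelativeModAbsolute.CurveFamiliesModCurves ∧
        Summit.KontsevichZagierPeriods.KontsevichZagierPeriods.Theses.RootDecompRelativeModAbsolute.BaseLift) :=
  ⟨curves_and_baseLift_of_relOneModAbs, fun h => relOneModAbsGlue_proof h.1 h.2⟩

end Summit.KontsevichZagierPeriods.RootDecompRelativeModAbsolute
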